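import Mathlib.Analysis.Calculus.InverseFunctionTheorem.ContDiff
import Mathlib.Analysis.Normed.Ring.Units
import Mathlib.Geometry.Manifold.ContMDiff.Atlas
import Literature.Topology.FourManifolds.Diffeotopy
import HarnessLib

/-!
# The inverse function theorem on manifolds; tracks of ambient isotopies

Two pieces of differential-topology infrastructure absent from Mathlib (see the TODO list of
`Mathlib.Geometry.Manifold.LocalDiffeomorph`: "if `f` is `C^n` at `x` and `mfderiv I J n f x` is
a linear isomorphism, `f` is a local diffeomorphism at `x` (using the inverse function
theorem)"):

* `Literature.Topology.FourManifolds.isLocalDiffeomorphAt_of_hasFDerivAt_writtenInExtChartAt`,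
  `Literature.Topology.FourManifolds.isLocalDiffeomorphAt_of_mfderiv`: the **inverse function theorem on manifolds** without
  boundary — a map `f : M → N` which is `C^n` (`1 ≤ n`) on an open neighbourhood of `x` and whose
  differential at `x` (read in the extended charts, resp. `mfderiv`) is a continuous linear
  equivalence is a `C^n` local diffeomorphism at `x` (`IsLocalDiffeomorphAt`); hence a bijective
  such map is a diffeomorphism (`Literature.Topology.FourManifolds.diffeomorphOfBijectiveOfMfderiv`, via Mathlib's
  `IsLocalDiffeomorph.diffeomorphOfBijective`). Lee, *Introduction to Smooth Manifolds* (2013),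
  Ch. 4 (the inverse function theorem for manifolds and its corollaries).
* `Literature.Topology.FourManifolds.AmbientIsotopy.trackDiffeomorph`, `Literature.Topology.FourManifolds.AmbientIsotopy.toDiffeotopy`,
  `Literature.Topology.FourManifolds.AmbientIsotopy.isDiffeotopicToId_of_boundaryless`: for an ambient isotopy `F` of a
  manifold `N` without boundary and with complete model space (`Isotopy.lean`: stages
  bijective local diffeomorphisms,
  `(t, x) ↦ F_t x` jointly `C^∞`), the **track** `(t, x) ↦ (t, F_t x)` is a diffeomorphism of
  `ℝ × N` (its differential is a shear `ContinuousLinearEquiv.skewProd` with invertible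
  diagonal blocks), so `F` is a
  diffeotopy in the sense of `Diffeotopy.lean` (`AmbientIsotopy.exists_diffeotopy_of_boundaryless`,
  the boundaryless case of the named fact `Literature.Topology.FourManifolds.AmbientIsotopy.exists_diffeotopy`) and its stages
  are diffeotopic to the identity; consequently "diffeotopic" and "ambient isotopic" agree for
  diffeomorphisms of boundaryless manifolds
  (`Diffeomorph.isDiffeotopicToId_iff_isAmbientIsotopic`,
  `Diffeomorph.isDiffeotopic_iff_isAmbientIsotopic`). Hirsch (1976), Ch. 8 §1.

The hypotheses "`C^n` on an open set" (rather than at a point) matter for `n = ∞`: `C^∞` at a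
single point does not give a common neighbourhood on which all derivatives exist.

## References

* J. M. Lee, *Introduction to Smooth Manifolds*, 2nd ed., GTM 218 (2013), Ch. 4, Thm. 4.5
  (Inverse Function Theorem for Manifolds) and its corollaries.
* M. W. Hirsch, *Differential Topology*, GTM 33 (1976), Ch. 8 §1 (tracks of isotopies).
-/

open scoped Manifold ContDiff Topology
open Set Function

noncomputable section

namespace Literature.Topology.FourManifolds

section IFT

variable {E : Type*} [NormedAddCommGroup E] [NormedSpace ℝ E] [CompleteSpace E]
  {H : Type*} [TopologicalSpace H] {I : ModelWithCorners ℝ E H} [I.Boundaryless]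
  {M : Type*} [TopologicalSpace M] [ChartedSpace H M]
  {E' : Type*} [NormedAddCommGroup E'] [NormedSpace ℝ E']
  {H' : Type*} [TopologicalSpace H'] {J : ModelWithCorners ℝ E' H'} [J.Boundaryless]
  {N : Type*} [TopologicalSpace N] [ChartedSpace H' N]
  {n : WithTop ℕ∞}

variable (I) in
/-- The extended chart at `x` of a manifold modelled on a *boundaryless* model, bundled as an open
partial homeomorphism `M → E` (Mathlib's `extChartAt` is only a `PartialEquiv`): the chart at
`x` followed by the homeomorphism `I : H ≃ₜ E` (`ModelWithCorners.toHomeomorph`). [folklore] -/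
def extChartHomeomorph (x : M) : OpenPartialHomeomorph M E :=
  (chartAt H x).transHomeomorph I.toHomeomorph

omit [CompleteSpace E] in
/-- `extChartHomeomorph` is `extChartAt` as a function. [folklore] -/
@[simp]
theorem coe_extChartHomeomorph (x : M) : ⇑(extChartHomeomorph I x) = extChartAt I x := rfl

omit [CompleteSpace E] in
/-- The inverse of `extChartHomeomorph` is the inverse of `extChartAt` as a function.
[folklore] -/
@[simp]
theorem coe_extChartHomeomorph_symm (x : M) :
    ⇑(extChartHomeomorph I x).symm = (extChartAt I x).symm := rfl

omit [CompleteSpace E] in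
/-- The source of `extChartHomeomorph` is the source of the chart. [folklore] -/
@[simp]
theorem extChartHomeomorph_source (x : M) :
    (extChartHomeomorph I x).source = (extChartAt I x).source := by
  simp [extChartHomeomorph]

omit [CompleteSpace E] in
/-- The target of `extChartHomeomorph` is the target of `extChartAt`. [folklore] -/
@[simp]
theorem extChartHomeomorph_target (x : M) :
    (extChartHomeomorph I x).target = (extChartAt I x).target := by
  rw [extChartHomeomorph, OpenPartialHomeomorph.transHomeomorph_target, extChartAt_target,
    I.range_eq_univ, inter_univ]
  rfl

/-- **Inverse function theorem on manifolds (chart form).** Let `M`, `N` be manifolds over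
boundaryless models `I`, `J` (model vector spaces `E` complete, `E'`), `f : M → N` a map which
is `C^n`, `1 ≤ n`, on an open set `U ∋ x`, and suppose the map `f` read in the extended charts
at `x` and `f x` has an invertible derivative `L : E ≃L[ℝ] E'` at the point. Then `f` is a `C^n`
local diffeomorphism at `x`. Proof: apply the inverse function theorem on `E`
(`ContDiffAt.toOpenPartialHomeomorph`) to the chart representative `g`, restricted to the open
set where `g` is `C^n` with invertible derivative (invertibility is an open condition), and
conjugate back with the charts (Lee's Inverse Function Theorem for Manifolds).
[cite: LeeSmoothManifolds2013, Thm. 4.5] -/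
theorem isLocalDiffeomorphAt_of_hasFDerivAt_writtenInExtChartAt [IsManifold I n M]
    [IsManifold J n N] {f : M → N} {x : M} {U : Set M} (hU : IsOpen U) (hxU : x ∈ U)
    (hf : ContMDiffOn I J n f U) (hn : 1 ≤ n) (L : E ≃L[ℝ] E')
    (hL : HasFDerivAt (writtenInExtChartAt I J x f) (L : E →L[ℝ] E') (extChartAt I x x)) :
    IsLocalDiffeomorphAt I J n f x := by
  have hn0 : n ≠ 0 := by
    rintro rfl
    exact not_lt.2 hn zero_lt_one
  -- notation
  set φ := extChartAt I x with hφ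
  set ψ := extChartAt J (f x) with hψ
  set g : E → E' := writtenInExtChartAt I J x f with hg
  -- the open set `W = U ∩ f ⁻¹' ψ.source ∋ x` and its image `O` in the chart
  have hW : IsOpen (U ∩ f ⁻¹' ψ.source) :=
    hf.continuousOn.isOpen_inter_preimage hU (isOpen_extChartAt_source (f x))
  set O : Set E := φ.target ∩ φ.symm ⁻¹' (U ∩ f ⁻¹' ψ.source) with hO
  have hOopen : IsOpen O :=
    (continuousOn_extChartAt_symm x).isOpen_inter_preimage (isOpen_extChartAt_target x) hW
  have hxO : φ x ∈ O := by
    refine ⟨mem_extChartAt_target x, ?_⟩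
    rw [mem_preimage, extChartAt_to_inv]
    exact ⟨hxU, mem_extChartAt_source (f x)⟩
  have hgO : ContDiffOn ℝ n g O := (contMDiffOn_iff.1 hf).2 x (f x)
  -- the open subset `O' ⊆ O` where the derivative of `g` is invertible
  set A : E → E →L[ℝ] E := fun e => (L.symm : E' →L[ℝ] E).comp (fderiv ℝ g e) with hA
  have hAcont : ContinuousOn A O :=
    continuousOn_const.clm_comp (hgO.continuousOn_fderiv_of_isOpen hOopen hn)
  set O' : Set E := O ∩ A ⁻¹' {u | IsUnit u} with hO'
  have hO'open : IsOpen O' := hAcont.isOpen_inter_preimage hOopen Units.isOpen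
  have hAx : A (φ x) = 1 := by
    rw [hA]
    dsimp only
    rw [hL.fderiv]
    ext v
    simp
  have hxO' : φ x ∈ O' := ⟨hxO, by rw [mem_preimage, mem_setOf_eq, hAx]; exact isUnit_one⟩
  -- on `O'`, `g` is `C^n` with invertible derivative
  have hgAt : ∀ e ∈ O', ContDiffAt ℝ n g e := fun e he =>
    hgO.contDiffAt (hOopen.mem_nhds he.1)
  have hderiv : ∀ e ∈ O', ∃ Le : E ≃L[ℝ] E', HasFDerivAt g (Le : E →L[ℝ] E') e := by
    intro e he
    have hunit : IsUnit (A e) := he.2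
    refine ⟨(ContinuousLinearEquiv.unitsEquiv ℝ E hunit.unit).trans L, ?_⟩
    have hd : HasFDerivAt g (fderiv ℝ g e) e :=
      ((hgAt e he).differentiableAt hn0).hasFDerivAt
    convert hd using 1
    ext v
    simp [hA]
  -- the local inverse from the inverse function theorem on `E`, restricted to `O'`
  set G : OpenPartialHomeomorph E E' :=
    ((hgAt _ hxO').toOpenPartialHomeomorph g hL hn0).restrOpen O' hO'open with hGdef
  have hGcoe : (G : E → E') = g := rfl
  have hxG : φ x ∈ G.source :=
    ⟨(hgAt _ hxO').mem_toOpenPartialHomeomorph_source hL hn0, hxO'⟩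
  have hGsource : G.source ⊆ O' := fun e he => he.2
  have hGsymm : ContDiffOn ℝ n G.symm G.target := by
    intro a ha
    have ha' : G.symm a ∈ O' := hGsource (G.map_target ha)
    obtain ⟨Le, hLe⟩ := hderiv _ ha'
    exact (G.contDiffAt_symm ha hLe (hgAt _ ha')).contDiffWithinAt
  -- the local diffeomorphism `Φ = ψ⁻¹ ∘ G ∘ φ`
  set Φ : OpenPartialHomeomorph M N :=
    (extChartHomeomorph I x).trans (G.trans (extChartHomeomorph J (f x)).symm) with hΦdef
  have hΦcoe : ∀ y, Φ y = ψ.symm (g (φ y)) := fun y => rfl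
  have hΦsource : ∀ y ∈ Φ.source, y ∈ φ.source ∧ φ y ∈ O' := by
    intro y hy
    rw [hΦdef, OpenPartialHomeomorph.trans_source, OpenPartialHomeomorph.trans_source,
      extChartHomeomorph_source, coe_extChartHomeomorph] at hy
    exact ⟨hy.1, hGsource hy.2.1⟩
  have hΦeq : EqOn f Φ Φ.source := by
    intro y hy
    obtain ⟨hy1, hy2⟩ := hΦsource y hy
    have hy3 : y ∈ U ∩ f ⁻¹' ψ.source := by
      have := hy2.1.2
      rwa [mem_preimage, φ.left_inv hy1] at this
    rw [hΦcoe, hg, writtenInExtChartAt, Function.comp_apply, Function.comp_apply, ← hφ, ← hψ,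
      φ.left_inv hy1, ψ.left_inv hy3.2]
  have hxΦ : x ∈ Φ.source := by
    rw [hΦdef, OpenPartialHomeomorph.trans_source, OpenPartialHomeomorph.trans_source,
      extChartHomeomorph_source, coe_extChartHomeomorph]
    refine ⟨mem_extChartAt_source x, hxG, ?_⟩
    rw [mem_preimage, OpenPartialHomeomorph.symm_source, extChartHomeomorph_target, hGcoe, hg,
      writtenInExtChartAt, Function.comp_apply, Function.comp_apply, extChartAt_to_inv]
    exact mem_extChartAt_target (f x)
  refine ⟨{ toPartialEquiv := Φ.toPartialEquiv
            open_source := Φ.open_source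
            open_target := Φ.open_target
            contMDiffOn_toFun := ?_
            contMDiffOn_invFun := ?_ }, hxΦ, hΦeq⟩
  · -- `Φ = f` on the source, and `f` is `C^n` on `U ⊇ source`
    change ContMDiffOn I J n Φ Φ.source
    refine (hf.mono fun y hy => ?_).congr fun y hy => (hΦeq hy).symm
    obtain ⟨hy1, hy2⟩ := hΦsource y hy
    have := hy2.1.2
    rw [mem_preimage, φ.left_inv hy1] at this
    exact this.1
  · -- `Φ⁻¹ = φ⁻¹ ∘ G⁻¹ ∘ ψ` on the target
    change ContMDiffOn J I n Φ.symm Φ.target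
    have h1 : ContMDiffOn J 𝓘(ℝ, E') n ψ (chartAt H' (f x)).source := contMDiffOn_extChartAt
    have h2 : ContMDiffOn 𝓘(ℝ, E') 𝓘(ℝ, E) n G.symm G.target := hGsymm.contMDiffOn
    have h3 : ContMDiffOn 𝓘(ℝ, E) I n φ.symm φ.target := contMDiffOn_extChartAt_symm x
    have hT : ∀ z ∈ Φ.target, z ∈ (chartAt H' (f x)).source ∧ ψ z ∈ G.target ∧
        G.symm (ψ z) ∈ φ.target := by
      intro z hz
      rw [hΦdef, OpenPartialHomeomorph.trans_target, OpenPartialHomeomorph.trans_target,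
        OpenPartialHomeomorph.symm_target, extChartHomeomorph_source, mem_inter_iff,
        mem_inter_iff, mem_preimage, mem_preimage, OpenPartialHomeomorph.symm_symm,
        coe_extChartHomeomorph, OpenPartialHomeomorph.coe_trans_symm,
        OpenPartialHomeomorph.symm_symm, coe_extChartHomeomorph, Function.comp_apply,
        extChartHomeomorph_target] at hz
      exact ⟨by rw [← extChartAt_source J]; exact hz.1.1, hz.1.2, hz.2⟩
    have key : ∀ z, Φ.symm z = φ.symm (G.symm (ψ z)) := fun z => rfl
    have h1' : ContMDiffOn J 𝓘(ℝ, E') n ψ Φ.target := h1.mono fun z hz => (hT z hz).1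
    have h21 : ContMDiffOn J 𝓘(ℝ, E) n (G.symm ∘ ψ) Φ.target :=
      h2.comp h1' fun z hz => (hT z hz).2.1
    exact (h3.comp h21 fun z hz => (hT z hz).2.2).congr fun z _ => key z

/-- **Inverse function theorem on manifolds (`mfderiv` form).** A map between boundaryless
manifolds which is `C^n` (`1 ≤ n`) on an open neighbourhood of `x` and whose differential
`mfderiv I J f x` is a continuous linear equivalence is a `C^n` local diffeomorphism at `x`
(Lee's Inverse Function Theorem for Manifolds). [cite: LeeSmoothManifolds2013, Thm. 4.5] -/
theorem isLocalDiffeomorphAt_of_mfderiv [IsManifold I n M] [IsManifold J n N] {f : M → N}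
    {x : M} {U : Set M} (hU : IsOpen U) (hxU : x ∈ U) (hf : ContMDiffOn I J n f U) (hn : 1 ≤ n)
    (L : E ≃L[ℝ] E') (hL : mfderiv I J f x = (L : E →L[ℝ] E')) :
    IsLocalDiffeomorphAt I J n f x := by
  have hn0 : n ≠ 0 := by
    rintro rfl
    exact not_lt.2 hn zero_lt_one
  have hfx : ContMDiffAt I J n f x := hf.contMDiffAt (hU.mem_nhds hxU)
  have hmd : MDifferentiableAt I J f x := hfx.mdifferentiableAt hn0
  refine isLocalDiffeomorphAt_of_hasFDerivAt_writtenInExtChartAt hU hxU hf hn L ?_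
  have hd : DifferentiableWithinAt ℝ (writtenInExtChartAt I J x f) (range I) (extChartAt I x x) :=
    hmd.differentiableWithinAt_writtenInExtChartAt
  rw [I.range_eq_univ, differentiableWithinAt_univ] at hd
  have := hd.hasFDerivAt
  rwa [← fderivWithin_univ, ← I.range_eq_univ, ← hmd.mfderiv, hL] at this

/-- **A bijection which is everywhere a local diffeomorphism by the inverse function theorem is a
diffeomorphism**: global version of `isLocalDiffeomorphAt_of_mfderiv` combined with Mathlib's
`IsLocalDiffeomorph.diffeomorphOfBijective` (a corollary of the Inverse Function Theorem for
Manifolds). [cite: LeeSmoothManifolds2013, Ch. 4] -/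
def diffeomorphOfBijectiveOfMfderiv [IsManifold I n M] [IsManifold J n N] {f : M → N}
    (hf : ContMDiff I J n f) (hn : 1 ≤ n) (hbij : Bijective f)
    (L : M → E ≃L[ℝ] E') (hL : ∀ x, mfderiv I J f x = (L x : E →L[ℝ] E')) :
    M ≃ₘ^n⟮I, J⟯ N :=
  IsLocalDiffeomorph.diffeomorphOfBijective
    (fun x => isLocalDiffeomorphAt_of_mfderiv isOpen_univ (mem_univ x) hf.contMDiffOn hn (L x)
      (hL x)) hbij

/-- The diffeomorphism of `diffeomorphOfBijectiveOfMfderiv` is `f` as a function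
(definitional). [folklore] -/
@[simp]
theorem coe_diffeomorphOfBijectiveOfMfderiv [IsManifold I n M] [IsManifold J n N] {f : M → N}
    (hf : ContMDiff I J n f) (hn : 1 ≤ n) (hbij : Bijective f)
    (L : M → E ≃L[ℝ] E') (hL : ∀ x, mfderiv I J f x = (L x : E →L[ℝ] E')) :
    ⇑(diffeomorphOfBijectiveOfMfderiv hf hn hbij L hL) = f := rfl

end IFT

/-! ### The track of an ambient isotopy is a diffeomorphism -/

section Track

variable {EN : Type*} [NormedAddCommGroup EN] [NormedSpace ℝ EN] [CompleteSpace EN]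
  {HN : Type*} [TopologicalSpace HN] {J : ModelWithCorners ℝ EN HN}
  {N : Type*} [TopologicalSpace N] [ChartedSpace HN N]

namespace AmbientIsotopy

/-- The **track** `(t, x) ↦ (t, F_t x)` of an ambient isotopy, as a function on `ℝ × N`.
[cite: HirschDT1976, Ch. 8 §1, p. 178] -/
def trackFun (F : AmbientIsotopy J N) (p : ℝ × N) : ℝ × N :=
  (p.1, F.toFun p.1 p.2)

omit [CompleteSpace EN] in
/-- The track in coordinates (definitional). [folklore] -/
@[simp]
theorem trackFun_apply (F : AmbientIsotopy J N) (t : ℝ) (x : N) :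
    F.trackFun (t, x) = (t, F.toFun t x) := rfl

omit [CompleteSpace EN] in
/-- The track is `C^∞`. [folklore] -/
theorem contMDiff_trackFun (F : AmbientIsotopy J N) :
    ContMDiff (𝓘(ℝ, ℝ).prod J) (𝓘(ℝ, ℝ).prod J) ∞ F.trackFun :=
  contMDiff_fst.prodMk F.contMDiff

omit [CompleteSpace EN] in
/-- The track is bijective (each stage is). [folklore] -/
theorem bijective_trackFun (F : AmbientIsotopy J N) : Bijective F.trackFun := by
  refine ⟨fun p q h => ?_, fun q => ?_⟩
  · obtain ⟨t, x⟩ := p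
    obtain ⟨t', x'⟩ := q
    simp only [trackFun_apply, Prod.mk.injEq] at h
    obtain ⟨rfl, h2⟩ := h
    exact Prod.ext rfl ((F.bijective t).1 h2)
  · obtain ⟨t, y⟩ := q
    obtain ⟨x, hx⟩ := (F.bijective t).2 y
    exact ⟨(t, x), Prod.ext rfl hx⟩

variable [J.Boundaryless] [IsManifold J ∞ N]

/-- **The track of an ambient isotopy is a local diffeomorphism** (boundaryless `N`): at
`(t₀, x₀)` its differential read in product charts is `(s, v) ↦ (s, D (s, v))` with
`v ↦ D (0, v)` the (invertible) differential `B` of the stage `F_{t₀}` at `x₀`, hence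
invertible (it is the shear `ContinuousLinearEquiv.skewProd (refl ℝ ℝ) B (D ∘ inl)`); conclude
by the inverse function theorem on manifolds on manifolds
(`isLocalDiffeomorphAt_of_hasFDerivAt_writtenInExtChartAt`); the model space `EN` is assumed
complete. [cite: HirschDT1976, Ch. 8 §1, p. 178] -/
theorem isLocalDiffeomorph_trackFun (F : AmbientIsotopy J N) :
    IsLocalDiffeomorph (𝓘(ℝ, ℝ).prod J) (𝓘(ℝ, ℝ).prod J) ∞ F.trackFun := by
  rintro ⟨t₀, x₀⟩
  set φ := extChartAt J x₀ with hφ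
  set ψ := extChartAt J (F.toFun t₀ x₀) with hψ
  -- the stage `F t₀` and the family read in the charts `φ`, `ψ`
  set f₂ : ℝ × EN → EN := fun q => ψ (F.toFun q.1 (φ.symm q.2)) with hf₂
  have hchart : extChartAt (𝓘(ℝ, ℝ).prod J) ((t₀, x₀) : ℝ × N) =
      (PartialEquiv.refl ℝ).prod φ := by
    rw [extChartAt_prod, extChartAt_model_space_eq_id]
  have hchart' : extChartAt (𝓘(ℝ, ℝ).prod J) (F.trackFun (t₀, x₀)) =
      (PartialEquiv.refl ℝ).prod ψ := by
    rw [trackFun_apply, extChartAt_prod, extChartAt_model_space_eq_id]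
  have hpt : extChartAt (𝓘(ℝ, ℝ).prod J) ((t₀, x₀) : ℝ × N) (t₀, x₀) = (t₀, φ x₀) := by
    rw [hchart]
    rfl
  have hW : writtenInExtChartAt (𝓘(ℝ, ℝ).prod J) (𝓘(ℝ, ℝ).prod J) ((t₀, x₀) : ℝ × N)
      F.trackFun = fun q => (q.1, f₂ q) := by
    funext q
    rw [writtenInExtChartAt, hchart, hchart']
    rfl
  have hf₂W : writtenInExtChartAt (𝓘(ℝ, ℝ).prod J) J ((t₀, x₀) : ℝ × N) (uncurry F.toFun) =
      f₂ := by
    funext q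
    rw [writtenInExtChartAt, hchart]
    rfl
  -- `f₂` is differentiable at `(t₀, φ x₀)`
  have hFmd : MDifferentiableAt (𝓘(ℝ, ℝ).prod J) J (uncurry F.toFun) (t₀, x₀) :=
    F.contMDiff.contMDiffAt.mdifferentiableAt (by simp)
  have hf₂d : DifferentiableAt ℝ f₂ (t₀, φ x₀) := by
    have hd := hFmd.differentiableWithinAt_writtenInExtChartAt
    rw [ModelWithCorners.range_eq_univ, differentiableWithinAt_univ, hf₂W, hpt] at hd
    exact hd
  set D : ℝ × EN →L[ℝ] EN := fderiv ℝ f₂ (t₀, φ x₀) with hD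
  have hf₂' : HasFDerivAt f₂ D (t₀, φ x₀) := hf₂d.hasFDerivAt
  -- the differential of the stage `F t₀` at `x₀`, an equivalence `B` with `B v = D (0, v)`
  set B : EN ≃L[ℝ] EN := (F.isLocalDiffeomorph t₀ x₀).mfderivToContinuousLinearEquiv
    (by simp) with hBdef
  have hg₁ : writtenInExtChartAt J J x₀ (F.toFun t₀) = f₂ ∘ fun e => (t₀, e) := rfl
  have hg₁' : HasFDerivAt (writtenInExtChartAt J J x₀ (F.toFun t₀))
      (D.comp (ContinuousLinearMap.inr ℝ ℝ EN)) (φ x₀) := by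
    rw [hg₁]
    exact hf₂'.comp _ (hasFDerivAt_prodMk_right t₀ (φ x₀))
  have hB : ∀ v, B v = D (0, v) := by
    intro v
    have hmd : MDifferentiableAt J J (F.toFun t₀) x₀ :=
      (F.contMDiff_toFun t₀).contMDiffAt.mdifferentiableAt (by simp)
    have h1 : (B : EN →L[ℝ] EN) = mfderiv J J (F.toFun t₀) x₀ :=
      (F.isLocalDiffeomorph t₀ x₀).mfderivToContinuousLinearEquiv_coe _
    have h2 : mfderiv J J (F.toFun t₀) x₀ = D.comp (ContinuousLinearMap.inr ℝ ℝ EN) := by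
      rw [hmd.mfderiv, ModelWithCorners.range_eq_univ, fderivWithin_univ]
      exact hg₁'.fderiv
    change (B : EN →L[ℝ] EN) v = D (0, v)
    rw [h1, h2]
    rfl
  -- the differential of the track read in charts is the shear `(s, v) ↦ (s, D (s, v))`
  -- `= (s, B v + D (s, 0))`, i.e. Mathlib's `ContinuousLinearEquiv.skewProd`
  set L : (ℝ × EN) ≃L[ℝ] (ℝ × EN) :=
    (ContinuousLinearEquiv.refl ℝ ℝ).skewProd B (D.comp (ContinuousLinearMap.inl ℝ ℝ EN)) with hL
  have hLD : (L : ℝ × EN →L[ℝ] ℝ × EN) = (ContinuousLinearMap.fst ℝ ℝ EN).prod D := by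
    refine ContinuousLinearMap.ext fun q => ?_
    obtain ⟨s, v⟩ := q
    have h : D (0, v) + D (s, 0) = D (s, v) := by
      rw [← map_add, Prod.mk_add_mk, zero_add, add_zero]
    rw [hL, ContinuousLinearEquiv.coe_coe, ContinuousLinearEquiv.skewProd_apply,
      ContinuousLinearMap.prod_apply]
    dsimp only
    rw [ContinuousLinearEquiv.refl_apply, ContinuousLinearMap.comp_apply,
      ContinuousLinearMap.inl_apply, hB, h]
    rfl
  -- conclude by the inverse function theorem
  refine isLocalDiffeomorphAt_of_hasFDerivAt_writtenInExtChartAt isOpen_univ (mem_univ _)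
    F.contMDiff_trackFun.contMDiffOn (by exact_mod_cast le_top) L ?_
  rw [hW, hpt, hLD]
  exact hasFDerivAt_fst.prodMk hf₂'

/-- **The track of an ambient isotopy of a boundaryless manifold (complete model space) as a
diffeomorphism of `ℝ × N`.** [cite: HirschDT1976, Ch. 8 §1, p. 178] -/
def trackDiffeomorph (F : AmbientIsotopy J N) :
    (ℝ × N) ≃ₘ⟮𝓘(ℝ, ℝ).prod J, 𝓘(ℝ, ℝ).prod J⟯ (ℝ × N) :=
  F.isLocalDiffeomorph_trackFun.diffeomorphOfBijective F.bijective_trackFun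

/-- The track diffeomorphism as a function (definitional). [folklore] -/
@[simp]
theorem coe_trackDiffeomorph (F : AmbientIsotopy J N) : ⇑F.trackDiffeomorph = F.trackFun := rfl

/-- **An ambient isotopy of a boundaryless manifold (complete model space) is a diffeotopy**:
its inverse family `(t, y) ↦ F_t⁻¹ y` is jointly smooth (from the inverse of the track
diffeomorphism). [cite: HirschDT1976, Ch. 8 §1, p. 178] -/
def toDiffeotopy (F : AmbientIsotopy J N) : Diffeotopy J N where
  track := F.trackDiffeomorph
  track_fst _ := rfl
  track_zero x := by
    change F.toFun 0 x = x
    rw [F.map_zero, id]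

/-- The stages of the diffeotopy of an ambient isotopy are its stages. [folklore] -/
@[simp]
theorem toDiffeotopy_toFun (F : AmbientIsotopy J N) : F.toDiffeotopy.toFun = F.toFun := rfl

/-- The stage diffeomorphisms agree with `AmbientIsotopy.toDiffeomorph`. [folklore] -/
theorem toDiffeotopy_stage (F : AmbientIsotopy J N) (t : ℝ) :
    F.toDiffeotopy.stage t = F.toDiffeomorph t :=
  Diffeomorph.ext fun _ => rfl

/-- **Boundaryless case (complete model space) of the named fact
`AmbientIsotopy.exists_diffeotopy`** (`Diffeotopy.lean`; the fact itself, for models with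
corners, stays open): an ambient isotopy is the stage family of a diffeotopy, namely of
`F.toDiffeotopy`. Hirsch (1976), Ch. 8 §1, p. 178.
[cite: HirschDT1976, Ch. 8 §1, p. 178] -/
theorem exists_diffeotopy_of_boundaryless (F : AmbientIsotopy J N) :
    ∃ D : Diffeotopy J N, D.toFun = F.toFun :=
  ⟨F.toDiffeotopy, rfl⟩

/-- Every stage `F_t` of an ambient isotopy of a manifold without boundary (complete model
space) is diffeotopic to the identity — reparametrise the diffeotopy `F.toDiffeotopy` by
`s ↦ s t` (boundaryless case of `AmbientIsotopy.isDiffeotopicToId_of_exists_diffeotopy`,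
unconditionally). Hirsch (1976), Ch. 8 §1, p. 178. [cite: HirschDT1976, Ch. 8 §1, p. 178] -/
theorem isDiffeotopicToId_of_boundaryless (F : AmbientIsotopy J N) (t : ℝ) :
    Diffeomorph.IsDiffeotopicToId (F.toDiffeomorph t) := by
  refine ⟨F.toDiffeotopy.reparam (fun s => s * t) (contDiff_id.mul contDiff_const)
    (zero_mul t), Diffeomorph.ext fun x => ?_⟩
  simp

end AmbientIsotopy

/-- For boundaryless manifolds with complete model space, **diffeotopic to the identity =
ambient isotopic to the identity** (`Diffeotopy.lean` vs `Isotopy.lean`). [folklore] -/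
theorem Diffeomorph.isDiffeotopicToId_iff_isAmbientIsotopic [J.Boundaryless] [IsManifold J ∞ N]
    (φ : N ≃ₘ⟮J, J⟯ N) :
    Diffeomorph.IsDiffeotopicToId φ ↔ IsAmbientIsotopic J J (id : N → N) ⇑φ := by
  refine ⟨Diffeomorph.IsDiffeotopicToId.isAmbientIsotopic, ?_⟩
  rintro ⟨F, hF⟩
  have h : F.toDiffeomorph 1 = φ := Diffeomorph.ext fun x => congrFun hF x
  exact h ▸ F.isDiffeotopicToId_of_boundaryless 1

/-- For boundaryless manifolds with complete model space, **diffeotopic = ambient isotopic**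
for pairs of diffeomorphisms. [folklore] -/
theorem Diffeomorph.isDiffeotopic_iff_isAmbientIsotopic [J.Boundaryless] [IsManifold J ∞ N]
    (φ ψ : N ≃ₘ⟮J, J⟯ N) :
    Diffeomorph.IsDiffeotopic φ ψ ↔ IsAmbientIsotopic J J ⇑φ ⇑ψ := by
  refine ⟨Diffeomorph.IsDiffeotopic.isAmbientIsotopic, ?_⟩
  rintro ⟨F, hF⟩
  have h : F.toDiffeomorph 1 = φ.symm.trans ψ := Diffeomorph.ext fun y => by
    have := congrFun hF (φ.symm y)
    simpa using this
  rw [Diffeomorph.isDiffeotopic_iff, ← h]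
  exact F.isDiffeotopicToId_of_boundaryless 1

end Track

end Literature.Topology.FourManifolds

end
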